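import Literature.Analysis.FluidPDE.EnergyUniqueness
import Literature.Analysis.FluidPDE.WholeSpaceIBPIntegrable
import HarnessLib

/-!
# Whole-space integration by parts: a bounded field against a decaying field

Analysis/FluidPDE support file (everything proved; no definitions, no named facts).

Let `E` be a finite-dimensional real inner product space with Lebesgue measure and `F'` a real
inner product space.  The tree's boundary-free integration-by-parts identities on `E` assume
either compact support of one factor (`WholeSpaceIBP`: `integral_inner_laplacian_comm`,
`integral_inner_convect_add_eq_zero`), power decay of BOTH factors (`EnergyUniqueness`,
`NSVorticityHelicityProofs`) or `L¹` hypotheses (`WholeSpaceIBPIntegrable`).  Duality arguments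
for transport–diffusion equations pair a merely BOUNDED field (with bounded derivatives; e.g. the
vorticity of a bounded classical solution) with a test field DECAYING like `(1 + ‖x‖)^{-r}`,
`r > dim E`, together with its derivatives; this file records that mixed case:

* `integrable_inner_of_bdd_of_decay`, `integrable_inner_of_decay_of_bdd`: `⟪f, g⟫ ∈ L¹` for
  continuous `f`, `g`, one bounded and the other `O((1 + ‖x‖)^{-r})`.
* `integral_inner_laplacian_comm_of_bdd_of_decay` — Green's second identity
  `∫ ⟪Δw, φ⟫ = ∫ ⟪w, Δφ⟫` for `w ∈ C²` with `w, Dw, D²w` bounded and `φ ∈ C²` with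
  `φ, Dφ, D²φ = O((1 + ‖x‖)^{-r})` (coordinatewise, twice Mathlib's
  `integral_bilinear_hasFDerivAt_right_eq_neg_left_of_integrable`).
* `integral_inner_fderiv_apply_add_eq_zero_of_bdd_of_decay` — the transport pairing
  `∫ (⟪Dw(v), φ⟫ + ⟪w, Dφ(v)⟫) = 0` for a bounded divergence-free `C¹` drift `v`, `w ∈ C¹` bounded
  with bounded derivative and `φ ∈ C¹` decaying with its derivative (the integrand is
  `div (⟪w, φ⟫ v)`, and `integral_divergence_eq_zero_of_integrable` applies).

These are the integrations by parts of Majda–Bertozzi, §3.1.1 (p. 87: "the boundary terms vanish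
because we assume that `v` decays sufficiently rapidly at infinity"), with the decay put on one
factor only.

## References

* A. J. Majda, A. L. Bertozzi, *Vorticity and Incompressible Flow*, Cambridge Texts in Applied
  Mathematics 27, CUP (2002), §3.1.1, p. 87. [MajdaBertozziCUP2002]
-/

noncomputable section

open MeasureTheory Set Function Filter Topology InnerProductSpace
open scoped RealInnerProductSpace Laplacian

namespace Literature.Analysis.FluidPDE

variable {E : Type*} [NormedAddCommGroup E] [InnerProductSpace ℝ E] [FiniteDimensional ℝ E]
  [MeasurableSpace E] [BorelSpace E]
variable {F' : Type*} [NormedAddCommGroup F'] [InnerProductSpace ℝ F']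

/-! ### Integrability of bounded × decaying pairings -/

/-- `x ↦ ⟪f x, g x⟫` is integrable when `f`, `g` are continuous, `f` is bounded and `g` decays like
`(1 + ‖x‖)^{-r}` with `dim E < r` (domination by `M C (1 + ‖x‖)^{-r}`, Mathlib
`integrable_one_add_norm`). [folklore] -/
theorem integrable_inner_of_bdd_of_decay {f g : E → F'} (hf : Continuous f) (hg : Continuous g)
    {M C r : ℝ} (hr : (Module.finrank ℝ E : ℝ) < r)
    (hfb : ∀ x, ‖f x‖ ≤ M) (hgb : ∀ x, ‖g x‖ ≤ C * (1 + ‖x‖) ^ (-r)) :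
    Integrable (fun x => ⟪f x, g x⟫) (volume : Measure E) :=
  integrable_of_norm_le_const_mul_decay (hf.inner hg) hr fun x =>
    (norm_inner_le_norm _ _).trans
      (mul_le_mul (hfb x) (hgb x) (norm_nonneg _) ((norm_nonneg _).trans (hfb x)))

/-- `x ↦ ⟪f x, g x⟫` is integrable when `f`, `g` are continuous, `f` decays like `(1 + ‖x‖)^{-r}`
with `dim E < r` and `g` is bounded. [folklore] -/
theorem integrable_inner_of_decay_of_bdd {f g : E → F'} (hf : Continuous f) (hg : Continuous g)
    {M C r : ℝ} (hr : (Module.finrank ℝ E : ℝ) < r)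
    (hfb : ∀ x, ‖f x‖ ≤ C * (1 + ‖x‖) ^ (-r)) (hgb : ∀ x, ‖g x‖ ≤ M) :
    Integrable (fun x => ⟪f x, g x⟫) (volume : Measure E) :=
  (integrable_inner_of_bdd_of_decay hg hf hr hgb hfb).congr
    (Eventually.of_forall fun _ => real_inner_comm _ _)

/-! ### Green's second identity -/

/-- **Green's second identity on the whole space, bounded against decaying.**  For
`w ∈ C²(E; F')` with `w`, `Dw`, `D²w` bounded by `M` and `φ ∈ C²(E; F')` with `φ`, `Dφ`, `D²φ`
bounded by `C (1 + ‖x‖)^{-r}`, `dim E < r`: `∫ ⟪Δw, φ⟫ = ∫ ⟪w, Δφ⟫`.  Proof: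
`Δ = Σᵢ D²(·)(bᵢ, bᵢ)` in an orthonormal frame and, for each `i`, twice Mathlib's bilinear
integration by parts, `∫ ⟪D²w(bᵢ,bᵢ), φ⟫ = −∫ ⟪Dw bᵢ, Dφ bᵢ⟫ = ∫ ⟪w, D²φ(bᵢ,bᵢ)⟫`; every
product is bounded × decaying, hence integrable, and there are no boundary terms
(Majda–Bertozzi, §3.1.1, p. 87, with the decay on one factor only).
[cite: MajdaBertozziCUP2002, §3.1.1 p. 87 (whole-space integration by parts for the Laplacian)] -/
theorem integral_inner_laplacian_comm_of_bdd_of_decay {w φ : E → F'} (hw : ContDiff ℝ 2 w)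
    (hφ : ContDiff ℝ 2 φ) {M C r : ℝ} (hr : (Module.finrank ℝ E : ℝ) < r)
    (hw0 : ∀ x, ‖w x‖ ≤ M) (hw1 : ∀ x, ‖fderiv ℝ w x‖ ≤ M)
    (hw2 : ∀ x, ‖fderiv ℝ (fderiv ℝ w) x‖ ≤ M)
    (hφ0 : ∀ x, ‖φ x‖ ≤ C * (1 + ‖x‖) ^ (-r)) (hφ1 : ∀ x, ‖fderiv ℝ φ x‖ ≤ C * (1 + ‖x‖) ^ (-r))
    (hφ2 : ∀ x, ‖fderiv ℝ (fderiv ℝ φ) x‖ ≤ C * (1 + ‖x‖) ^ (-r)) :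
    ∫ x, ⟪(Δ w) x, φ x⟫ = ∫ x, ⟪w x, (Δ φ) x⟫ := by
  set b := stdOrthonormalBasis ℝ E
  have hw1' : ContDiff ℝ 1 w := hw.of_le one_le_two
  have hφ1' : ContDiff ℝ 1 φ := hφ.of_le one_le_two
  have hDw : ContDiff ℝ 1 (fderiv ℝ w) := hw.fderiv_right (m := 1) (by norm_num)
  have hDφ : ContDiff ℝ 1 (fderiv ℝ φ) := hφ.fderiv_right (m := 1) (by norm_num)
  have hwc : Continuous w := hw.continuous
  have hφc : Continuous φ := hφ.continuous
  have hDwc : Continuous (fderiv ℝ w) := hw.continuous_fderiv two_ne_zero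
  have hDφc : Continuous (fderiv ℝ φ) := hφ.continuous_fderiv two_ne_zero
  have hD2wc : Continuous (fderiv ℝ (fderiv ℝ w)) := hDw.continuous_fderiv one_ne_zero
  have hD2φc : Continuous (fderiv ℝ (fderiv ℝ φ)) := hDφ.continuous_fderiv one_ne_zero
  have hfw : ∀ x, HasFDerivAt w (fderiv ℝ w x) x := fun x =>
    (hw1'.differentiable one_ne_zero x).hasFDerivAt
  have hfφ : ∀ x, HasFDerivAt φ (fderiv ℝ φ x) x := fun x =>
    (hφ1'.differentiable one_ne_zero x).hasFDerivAt
  have hfDw : ∀ x, HasFDerivAt (fderiv ℝ w) (fderiv ℝ (fderiv ℝ w) x) x := fun x =>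
    (hDw.differentiable one_ne_zero x).hasFDerivAt
  have hfDφ : ∀ x, HasFDerivAt (fderiv ℝ φ) (fderiv ℝ (fderiv ℝ φ) x) x := fun x =>
    (hDφ.differentiable one_ne_zero x).hasFDerivAt
  -- pointwise bounds in the frame
  have bw1 : ∀ i x, ‖fderiv ℝ w x (b i)‖ ≤ M := fun i x =>
    (norm_apply_orthonormalBasis_le b i _).trans (hw1 x)
  have bw2 : ∀ i x, ‖fderiv ℝ (fderiv ℝ w) x (b i) (b i)‖ ≤ M := fun i x =>
    ((norm_apply_orthonormalBasis_le b i _).trans (norm_apply_orthonormalBasis_le b i _)).trans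
      (hw2 x)
  have bφ1 : ∀ i x, ‖fderiv ℝ φ x (b i)‖ ≤ C * (1 + ‖x‖) ^ (-r) := fun i x =>
    (norm_apply_orthonormalBasis_le b i _).trans (hφ1 x)
  have bφ2 : ∀ i x, ‖fderiv ℝ (fderiv ℝ φ) x (b i) (b i)‖ ≤ C * (1 + ‖x‖) ^ (-r) := fun i x =>
    ((norm_apply_orthonormalBasis_le b i _).trans (norm_apply_orthonormalBasis_le b i _)).trans
      (hφ2 x)
  -- integrability of the products (bounded × decaying)
  have I1 : ∀ i, Integrable (fun x => ⟪fderiv ℝ (fderiv ℝ w) x (b i) (b i), φ x⟫)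
      (volume : Measure E) := fun i =>
    integrable_inner_of_bdd_of_decay
      ((hD2wc.clm_apply continuous_const).clm_apply continuous_const) hφc hr (bw2 i) hφ0
  have I2 : ∀ i, Integrable (fun x => ⟪fderiv ℝ w x (b i), fderiv ℝ φ x (b i)⟫)
      (volume : Measure E) := fun i =>
    integrable_inner_of_bdd_of_decay (hDwc.clm_apply continuous_const)
      (hDφc.clm_apply continuous_const) hr (bw1 i) (bφ1 i)
  have I3 : ∀ i, Integrable (fun x => ⟪fderiv ℝ w x (b i), φ x⟫) (volume : Measure E) := fun i =>
    integrable_inner_of_bdd_of_decay (hDwc.clm_apply continuous_const) hφc hr (bw1 i) hφ0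
  have I4 : ∀ i, Integrable (fun x => ⟪fderiv ℝ (fderiv ℝ φ) x (b i) (b i), w x⟫)
      (volume : Measure E) := fun i =>
    integrable_inner_of_decay_of_bdd
      ((hD2φc.clm_apply continuous_const).clm_apply continuous_const) hwc hr (bφ2 i) hw0
  have I5 : ∀ i, Integrable (fun x => ⟪fderiv ℝ φ x (b i), fderiv ℝ w x (b i)⟫)
      (volume : Measure E) := fun i =>
    integrable_inner_of_decay_of_bdd (hDφc.clm_apply continuous_const)
      (hDwc.clm_apply continuous_const) hr (bφ1 i) (bw1 i)
  have I6 : ∀ i, Integrable (fun x => ⟪fderiv ℝ φ x (b i), w x⟫) (volume : Measure E) := fun i =>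
    integrable_inner_of_decay_of_bdd (hDφc.clm_apply continuous_const) hwc hr (bφ1 i) hw0
  -- integration by parts, twice, one coordinate at a time
  have ibp1 : ∀ i, ∫ x, ⟪fderiv ℝ w x (b i), fderiv ℝ φ x (b i)⟫ =
      -∫ x, ⟪fderiv ℝ (fderiv ℝ w) x (b i) (b i), φ x⟫ := by
    intro i
    have H := integral_bilinear_hasFDerivAt_right_eq_neg_left_of_integrable
      (μ := (volume : Measure E)) (f := fderiv ℝ w) (f' := fderiv ℝ (fderiv ℝ w)) (g := φ)
      (g' := fderiv ℝ φ) (v := b i)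
      (B := (innerSL ℝ (E := F')).comp (ContinuousLinearMap.apply ℝ F' (b i)))
      (by simpa using I1 i) (by simpa using I2 i) (by simpa using I3 i)
      (fun x _ => hfDw x) (fun x _ => hfφ x)
    simpa using H
  have ibp2 : ∀ i, ∫ x, ⟪fderiv ℝ (fderiv ℝ φ) x (b i) (b i), w x⟫ =
      -∫ x, ⟪fderiv ℝ φ x (b i), fderiv ℝ w x (b i)⟫ := by
    intro i
    have H := integral_bilinear_hasFDerivAt_right_eq_neg_left_of_integrable
      (μ := (volume : Measure E)) (f := w) (f' := fderiv ℝ w) (g := fderiv ℝ φ)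
      (g' := fderiv ℝ (fderiv ℝ φ)) (v := b i)
      (B := ((innerSL ℝ (E := F')).comp (ContinuousLinearMap.apply ℝ F' (b i))).flip)
      (by simpa using I5 i) (by simpa using I4 i) (by simpa using I6 i)
      (fun x _ => hfw x) (fun x _ => hfDφ x)
    simpa using H
  have hcomp : ∀ i, ∫ x, ⟪fderiv ℝ (fderiv ℝ w) x (b i) (b i), φ x⟫ =
      ∫ x, ⟪w x, fderiv ℝ (fderiv ℝ φ) x (b i) (b i)⟫ := by
    intro i
    have e1 : ∫ x, ⟪fderiv ℝ w x (b i), fderiv ℝ φ x (b i)⟫ =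
        ∫ x, ⟪fderiv ℝ φ x (b i), fderiv ℝ w x (b i)⟫ :=
      integral_congr_ae (Eventually.of_forall fun x => real_inner_comm _ _)
    have e2 : ∫ x, ⟪w x, fderiv ℝ (fderiv ℝ φ) x (b i) (b i)⟫ =
        ∫ x, ⟪fderiv ℝ (fderiv ℝ φ) x (b i) (b i), w x⟫ :=
      integral_congr_ae (Eventually.of_forall fun x => real_inner_comm _ _)
    linarith [ibp1 i, ibp2 i]
  have I4' : ∀ i, Integrable (fun x => ⟪w x, fderiv ℝ (fderiv ℝ φ) x (b i) (b i)⟫)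
      (volume : Measure E) := fun i =>
    (I4 i).congr (Eventually.of_forall fun x => real_inner_comm _ _)
  calc ∫ x, ⟪(Δ w) x, φ x⟫ = ∫ x, ∑ i, ⟪fderiv ℝ (fderiv ℝ w) x (b i) (b i), φ x⟫ := by
        refine integral_congr_ae (Eventually.of_forall fun x => ?_)
        simp only [laplacian_apply_eq_sum_fderiv_fderiv b, sum_inner]
    _ = ∑ i, ∫ x, ⟪fderiv ℝ (fderiv ℝ w) x (b i) (b i), φ x⟫ :=
        integral_finsetSum _ fun i _ => I1 i
    _ = ∑ i, ∫ x, ⟪w x, fderiv ℝ (fderiv ℝ φ) x (b i) (b i)⟫ :=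
        Finset.sum_congr rfl fun i _ => hcomp i
    _ = ∫ x, ∑ i, ⟪w x, fderiv ℝ (fderiv ℝ φ) x (b i) (b i)⟫ :=
        (integral_finsetSum _ fun i _ => I4' i).symm
    _ = ∫ x, ⟪w x, (Δ φ) x⟫ := by
        refine integral_congr_ae (Eventually.of_forall fun x => ?_)
        simp only [laplacian_apply_eq_sum_fderiv_fderiv b, inner_sum]

/-! ### The transport pairing -/

/-- **The transport pairing vanishes, bounded against decaying.**  For a bounded
divergence-free `C¹` drift `v`, a `C¹` field `w` bounded by `M` together with its derivative, and
a `C¹` field `φ` decaying with its derivative like `C (1 + ‖x‖)^{-r}`, `dim E < r`: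
`∫ (⟪Dw(x)(v x), φ x⟫ + ⟪w x, Dφ(x)(v x)⟫) dx = 0`.  Proof: the integrand is
`D⟪w, φ⟫(v) = div (⟪w, φ⟫ v)` (`div v = 0`); the flux `⟪w, φ⟫ v` is `C¹` and integrable and
its divergence is integrable, so `integral_divergence_eq_zero_of_integrable` applies
(Majda–Bertozzi, §3.1.1, p. 87: `∫ (v·∇w) w = ∫ div(…) = 0`, with the decay on one factor only).
[cite: MajdaBertozziCUP2002, §3.1.1 p. 87 (transport term)] -/
theorem integral_inner_fderiv_apply_add_eq_zero_of_bdd_of_decay {v : E → E} {w φ : E → F'}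
    (hv : ContDiff ℝ 1 v) (hw : ContDiff ℝ 1 w) (hφ : ContDiff ℝ 1 φ)
    (hdiv : VectorCalculus.IsDivFree v) {M C r : ℝ} (hr : (Module.finrank ℝ E : ℝ) < r)
    (hv0 : ∀ x, ‖v x‖ ≤ M) (hw0 : ∀ x, ‖w x‖ ≤ M) (hw1 : ∀ x, ‖fderiv ℝ w x‖ ≤ M)
    (hφ0 : ∀ x, ‖φ x‖ ≤ C * (1 + ‖x‖) ^ (-r)) (hφ1 : ∀ x, ‖fderiv ℝ φ x‖ ≤ C * (1 + ‖x‖) ^ (-r)) :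
    ∫ x, (⟪fderiv ℝ w x (v x), φ x⟫ + ⟪w x, fderiv ℝ φ x (v x)⟫) = 0 := by
  haveI : CompleteSpace E := FiniteDimensional.complete ℝ E
  have hM : 0 ≤ M := (norm_nonneg _).trans (hv0 0)
  have hCw : ∀ x, 0 ≤ C * (1 + ‖x‖) ^ (-r) := fun x => (norm_nonneg _).trans (hφ0 x)
  have hθ : ContDiff ℝ 1 fun y => ⟪w y, φ y⟫ := hw.inner ℝ hφ
  have hF1 : ContDiff ℝ 1 fun y => ⟪w y, φ y⟫ • v y := hθ.smul hv
  have hwd : ∀ y, DifferentiableAt ℝ w y := fun y => hw.differentiable one_ne_zero y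
  have hφd : ∀ y, DifferentiableAt ℝ φ y := fun y => hφ.differentiable one_ne_zero y
  have hvd : ∀ y, DifferentiableAt ℝ v y := fun y => hv.differentiable one_ne_zero y
  have hθd : ∀ y, DifferentiableAt ℝ (fun y => ⟪w y, φ y⟫) y := fun y =>
    hθ.differentiable one_ne_zero y
  -- the divergence of the flux `⟪w, φ⟫ v`
  have hdivF : ∀ y, VectorCalculus.divergence (fun z => ⟪w z, φ z⟫ • v z) y =
      ⟪fderiv ℝ w y (v y), φ y⟫ + ⟪w y, fderiv ℝ φ y (v y)⟫ := by
    intro y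
    rw [divergence_smul_apply (hθd y) (hvd y), hdiv y, mul_zero, zero_add, gradient,
      real_inner_comm, InnerProductSpace.toDual_symm_apply,
      fderiv_inner_apply ℝ (hwd y) (hφd y)]
    exact add_comm _ _
  -- the flux is integrable
  have hFi : Integrable (fun y => ⟪w y, φ y⟫ • v y) (volume : Measure E) := by
    refine ((integrable_one_add_norm hr).const_mul (M * C * M)).mono'
      hF1.continuous.aestronglyMeasurable (Eventually.of_forall fun y => ?_)
    rw [norm_smul]
    calc ‖⟪w y, φ y⟫‖ * ‖v y‖ ≤ (‖w y‖ * ‖φ y‖) * ‖v y‖ := by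
          gcongr; exact norm_inner_le_norm _ _
      _ ≤ (M * (C * (1 + ‖y‖) ^ (-r))) * M :=
          mul_le_mul (mul_le_mul (hw0 y) (hφ0 y) (norm_nonneg _) hM) (hv0 y) (norm_nonneg _)
            (mul_nonneg hM (hCw y))
      _ = M * C * M * (1 + ‖y‖) ^ (-r) := by ring
  -- the divergence is integrable
  have hI1 : Integrable (fun y => ⟪fderiv ℝ w y (v y), φ y⟫) (volume : Measure E) :=
    integrable_inner_of_bdd_of_decay ((hw.continuous_fderiv one_ne_zero).clm_apply hv.continuous)
      hφ.continuous hr (M := M * M)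
      (fun y => (ContinuousLinearMap.le_opNorm _ _).trans
        (mul_le_mul (hw1 y) (hv0 y) (norm_nonneg _) hM)) hφ0
  have hI2 : Integrable (fun y => ⟪w y, fderiv ℝ φ y (v y)⟫) (volume : Measure E) := by
    refine integrable_inner_of_bdd_of_decay hw.continuous
      ((hφ.continuous_fderiv one_ne_zero).clm_apply hv.continuous) hr (C := C * M) hw0 fun y => ?_
    calc ‖fderiv ℝ φ y (v y)‖ ≤ ‖fderiv ℝ φ y‖ * ‖v y‖ := ContinuousLinearMap.le_opNorm _ _
      _ ≤ C * (1 + ‖y‖) ^ (-r) * M := mul_le_mul (hφ1 y) (hv0 y) (norm_nonneg _) (hCw y)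
      _ = C * M * (1 + ‖y‖) ^ (-r) := by ring
  have hdi : Integrable (fun y => VectorCalculus.divergence (fun z => ⟪w z, φ z⟫ • v z) y)
      (volume : Measure E) := by
    simp_rw [hdivF]
    exact hI1.add hI2
  have h := integral_divergence_eq_zero_of_integrable hF1 hFi hdi
  simp_rw [hdivF] at h
  exact h

end Literature.Analysis.FluidPDE
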